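import Literature.MathematicalPhysics.KineticTheory.LangevinChainMinorization
import Literature.MathematicalPhysics.KineticTheory.LangevinChainLinearControl
import Literature.Probability.Process.BrownianSkeletonLaw
import Literature.Analysis.Calculus.SubmersionLocalMinorization
import Mathlib.MeasureTheory.Measure.Lebesgue.EqHaar
import HarnessLib

/-!
# The pinned chain: a local small set at the equilibrium, at time one (Hörmander-free)

Trunk T-KINETIC (Literature/MathematicalPhysics/KineticTheory). Provefact unit for the named fact
`CuneoEckmannHairerReyBellet2018_thm213` (`LangevinSemigroup.lean`): the LOCAL MINORISATION of the
transition probabilities of the pinned anharmonic chain near its equilibrium `0`, at time `1`,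
proved without Hörmander's theorem by a finite-dimensional "partial Malliavin" argument:
conditionally on the Brownian bridges (`BrownianSkeleton.lean`), the solution at time `1` is a
`C¹` function of the dyadic skeleton `x ∈ (ℝ^{2^m})²` of the Brownian pair
(`LangevinChainSkeletonFlow.lean`), whose differential at `(z, x, ρ) = 0` is onto for a fine
enough level `m` (`LangevinChainLinearControl.lean`); an onto differential pushes the Gaussian law
of the skeleton (bounded below by Lebesgue measure on balls, `BrownianSkeletonLaw.lean`) forward
to a measure bounded below by Lebesgue measure near the image point, uniformly in the initial
condition `z` and the (small) remainder noise `ρ` (`SubmersionLocalMinorization.lean`); and the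
remainders are small with positive probability.

* `pinnedChain_minorization_at_one` — there are `ε₁, r, c > 0` with
  `P_1(z, T) ≥ c · Leb(T)` for all measurable `T ⊆ B(0, r)` and all `‖z‖ < ε₁`.

* `pinnedChain_transitionKernel_ball_ge_half` — `P_s(w, B(0,ε₁)) ≥ 1/2` for short `s`, uniformly
  near the equilibrium; `pinnedChain_localSmall` — the LOCAL SMALL SET at the equilibrium in the
  time window `[1, 1 + δ]` (hypothesis `hloc` of `LangevinChainMinorization.lean`, now PROVED);
* `CuneoEckmannHairerReyBellet2018_thm213_of_H2_of_hormander` — **CEHR Theorem 2.13 for the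
  pinned chain from the two named facts H2 and Hörmander's Theorem 1.1 alone.**

## References

* N. Cuneo, J.-P. Eckmann, M. Hairer, L. Rey-Bellet, EJP 23 (2018) no. 55, Prop. 3.6 (proof:
  "there exists `δ > 0` such that `inf_{z ∈ B(z₀,δ)} p_1(z, z⋆) > 0`").
* J. C. Mattingly, É. Pardoux, CPAM 59 (2006), §§3–4 (partial Malliavin / finite-dimensional
  controls). [folklore]
-/

noncomputable section

open MeasureTheory ProbabilityTheory Filter Topology Set Metric Function unitInterval
open scoped NNReal ENNReal

namespace Literature.MathematicalPhysics.KineticTheory.HeatConduction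

open Literature.Probability.Process Literature.Analysis.ODE Literature.Analysis.Calculus OscillatorChain

variable {N : ℕ}

/-! ### Small lemmas on the skeleton objects -/

/-- The piecewise-linear path starts at `0`. [folklore] -/
theorem plInterp_time_zero (m : ℕ) (y : Fin (2 ^ m) → ℝ) : plInterp m y 0 = 0 := by
  simp [plInterp, tentCoeff]

/-- The remainders of the Brownian pair vanish at time `0`. [folklore] -/
theorem pairRem_apply_zero (m : ℕ) (ω : WienerPair) : (pairRem m ω).1 0 = 0 ∧ (pairRem m ω).2 0 = 0 := by
  constructor <;> simp [pairRem, bridgeRem, plInterp_time_zero, pairPath]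

/-! ### The solution map through a reconstructed pair -/

section Recon

variable {ω₂ lam β γ : ℝ} (hω : 0 < ω₂) (hl : 0 ≤ lam) (hβ : 0 ≤ β) (hγ : 0 ≤ γ) (T_L T_R : ℝ)
  (m : ℕ)
  (η : PairSkeleton m → C(I, Fin N → ℝ) → ℝ → Fin N → ℝ)
  (hη : ∀ (x : PairSkeleton m) (ρ : C(I, Fin N → ℝ)) (t : ℝ) (i : Fin N),
    η x ρ t i = ρ (projIcc 0 1 zero_le_one t) i +
      ((if i.val = 0 then Real.sqrt (2 * γ * T_L) else 0) * plInterp m x.1 t.toNNReal +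
        (if i.val = N - 1 then Real.sqrt (2 * γ * T_R) else 0) * plInterp m x.2 t.toNNReal))
include hω hl hβ hγ hη

/-- **The SDE solution at time `1` through a reconstructed pair**: for a skeleton `x` and a pair
of continuous remainder paths `r` with `r(0) = 0`, `Φ_1(z, PL(x) + r) = S(z, x, ρ_r)(1)` with
`ρ_r(τ) = (c_L r¹_τ e_0 + c_R r²_τ e_{N-1})`. [folklore] -/
theorem solMap_one_pairRecon_eq_skelSol
    {S : PhaseSpace N × PairSkeleton m × C(I, Fin N → ℝ) → C(I, PhaseSpace N)}
    (hS : ∀ p τ, S p τ = (pinnedChain ω₂ lam β γ).chainFlow N p.1 (η p.2.1 p.2.2) τ)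
    (x : PairSkeleton m) {r : WienerPair} (hr1 : Continuous r.1) (hr2 : Continuous r.2)
    (hr10 : r.1 0 = 0) (hr20 : r.2 0 = 0) (ρr : C(I, Fin N → ℝ))
    (hρr : ∀ (τ : I) (i : Fin N), ρr τ i =
      (if i.val = 0 then Real.sqrt (2 * γ * T_L) else 0) * r.1 ⟨(τ : ℝ), τ.2.1⟩ +
        (if i.val = N - 1 then Real.sqrt (2 * γ * T_R) else 0) * r.2 ⟨(τ : ℝ), τ.2.1⟩)
    (z : PhaseSpace N) :
    (pinnedChain ω₂ lam β γ).solMap N T_L T_R 1 z (pairRecon m x r) = S (z, x, ρr) 1 := by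
  set P := pinnedChain ω₂ lam β γ with hP
  have hηc := continuous_skelNoise m _ _ η hη x ρr
  have hc1 : Continuous (pairRecon m x r).1 := (continuous_plInterp m x.1).add hr1
  have hc2 : Continuous (pairRecon m x r).2 := (continuous_plInterp m x.2).add hr2
  rw [hS]
  show P.chainFlow N z (chainNoise N (Real.sqrt (2 * P.γ * T_L)) (Real.sqrt (2 * P.γ * T_R))
    (pairRecon m x r)) 1 = P.chainFlow N z (η x ρr) ((1 : I) : ℝ)
  have hγP : P.γ = γ := rfl
  rw [hγP]
  refine pinnedChain_chainFlow_congr hω hl hβ hγ N z (continuous_chainNoise _ _ _) hηc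
    (T := 1) (fun t ht => ?_) ⟨zero_le_one, le_rfl⟩
  funext i
  rw [chainNoise_of_continuous _ _ hc1 hc2, hη]
  have hproj : projIcc 0 1 zero_le_one t = ⟨t, ht⟩ := projIcc_of_mem zero_le_one ht
  rw [hproj, hρr]
  have htnn : t.toNNReal = ⟨t, ht.1⟩ := Real.toNNReal_of_nonneg ht.1
  have h10 : (pairRecon m x r).1 0 = 0 := by
    show plInterp m x.1 0 + r.1 0 = 0
    rw [plInterp_time_zero, hr10, add_zero]
  have h20 : (pairRecon m x r).2 0 = 0 := by
    show plInterp m x.2 0 + r.2 0 = 0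
    rw [plInterp_time_zero, hr20, add_zero]
  have h1 : (pairRecon m x r).1 t.toNNReal = plInterp m x.1 t.toNNReal + r.1 ⟨t, ht.1⟩ := by
    show plInterp m x.1 t.toNNReal + r.1 t.toNNReal = _
    rw [htnn]
  have h2 : (pairRecon m x r).2 t.toNNReal = plInterp m x.2 t.toNNReal + r.2 ⟨t, ht.1⟩ := by
    show plInterp m x.2 t.toNNReal + r.2 t.toNNReal = _
    rw [htnn]
  simp only [h10, h20, sub_zero, h1, h2]
  ring

end Recon

/-! ### The minorisation at time one -/

section One

variable {ω₂ lam β γ : ℝ} (hω : 0 < ω₂) (hl : 0 ≤ lam) (hβ : 0 < β) (hγ : 0 < γ)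
  (hN : 0 < N) {T_L T_R : ℝ} (hL : 0 < T_L) (hR : 0 < T_R)
include hω hl hβ hγ hN hL hR

/-- **Local minorisation of the pinned chain at time one, near the equilibrium** (Hörmander-free):
there are `ε₁, r > 0` and `c > 0` such that `P_1(z, T) ≥ c · Leb(T)` for every measurable
`T ⊆ B(0, r)` and every initial condition `‖z‖ < ε₁`.
[cite: CuneoEckmannHairerReyBellet2018, Prop 3.6 (proof)] -/
theorem pinnedChain_minorization_at_one :
    ∃ ε₁ : ℝ, 0 < ε₁ ∧ ∃ r : ℝ, 0 < r ∧ ∃ c : ℝ≥0∞, 0 < c ∧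
      ∀ z : PhaseSpace N, ‖z‖ < ε₁ → ∀ T ⊆ ball (0 : PhaseSpace N) r, MeasurableSet T →
        c * volume T ≤ (pinnedChain ω₂ lam β γ).transitionKernel N T_L T_R 1 z T := by
  classical
  set cL : ℝ := Real.sqrt (2 * γ * T_L) with hcL
  set cR : ℝ := Real.sqrt (2 * γ * T_R) with hcR
  have hcLpos : 0 < cL := Real.sqrt_pos.2 (by positivity)
  have hcL0 : cL ≠ 0 := hcLpos.ne'
  -- the level `m` and the skeleton objects
  obtain ⟨m, hm⟩ := pinnedChain_exists_skeleton_level_surjective hω hl hβ.le hγ.le hN hcL0 cR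
  let η : PairSkeleton m → C(I, Fin N → ℝ) → ℝ → Fin N → ℝ := fun x ρ t i =>
    ρ (projIcc 0 1 zero_le_one t) i +
      ((if i.val = 0 then cL else 0) * plInterp m x.1 t.toNNReal +
        (if i.val = N - 1 then cR else 0) * plInterp m x.2 t.toNNReal)
  have hη : ∀ (x : PairSkeleton m) (ρ : C(I, Fin N → ℝ)) (t : ℝ) (i : Fin N),
      η x ρ t i = ρ (projIcc 0 1 zero_le_one t) i +
        ((if i.val = 0 then cL else 0) * plInterp m x.1 t.toNNReal +
          (if i.val = N - 1 then cR else 0) * plInterp m x.2 t.toNNReal) := fun _ _ _ _ => rfl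
  obtain ⟨g, hg⟩ := exists_skelForcingCLM m cL cR η hη
  obtain ⟨S, hSapply, hS, huniq, hdiff⟩ := exists_skelSol hω hl hβ.le hγ.le m cL cR η hη g hg 1 le_rfl
  have hS0 : S 0 = 0 := skelSol_zero hω hl hβ.le hγ.le m cL cR η hη hSapply
  have hsurjT := hm η hη g hg S hS huniq
  -- the map `f (z, ρ) x = S (z, x, ρ) 1` and its partial differential in `x`
  let ι : PairSkeleton m →L[ℝ] PhaseSpace N × PairSkeleton m × C(I, Fin N → ℝ) :=
    (ContinuousLinearMap.inr ℝ (PhaseSpace N) (PairSkeleton m × C(I, Fin N → ℝ))).comp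
      (ContinuousLinearMap.inl ℝ (PairSkeleton m) C(I, Fin N → ℝ))
  have hι : ∀ x : PairSkeleton m, ι x = ((0 : PhaseSpace N), x, (0 : C(I, Fin N → ℝ))) := fun x => rfl
  let f : PhaseSpace N × C(I, Fin N → ℝ) → PairSkeleton m → PhaseSpace N := fun p x => S (p.1, x, p.2) 1
  let f' : PhaseSpace N × C(I, Fin N → ℝ) → PairSkeleton m → PairSkeleton m →L[ℝ] PhaseSpace N :=
    fun p x => (ContinuousMap.evalCLM ℝ (1 : I)).comp ((fderiv ℝ S (p.1, x, p.2)).comp ι)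
  have hSd : Differentiable ℝ S := hdiff.differentiable one_ne_zero
  have hf' : ∀ p x, HasFDerivAt (f p) (f' p x) x := by
    intro p x
    have hA : HasFDerivAt (fun x : PairSkeleton m => (p.1, x, p.2)) ι x := by
      have h1 : (fun x : PairSkeleton m => (p.1, x, p.2)) = fun x => ι x + (p.1, 0, p.2) := by
        funext x; rw [hι]; simp
      rw [h1]
      exact ι.hasFDerivAt.add_const _
    have hSx := (hSd (p.1, x, p.2)).hasFDerivAt.comp x hA
    exact (ContinuousMap.evalCLM ℝ (1 : I)).hasFDerivAt.comp x hSx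
  have hcontf' : Continuous fun q : (PhaseSpace N × C(I, Fin N → ℝ)) × PairSkeleton m => f' q.1 q.2 := by
    have h1 : Continuous fun q : (PhaseSpace N × C(I, Fin N → ℝ)) × PairSkeleton m =>
        fderiv ℝ S (q.1.1, q.2, q.1.2) :=
      (hdiff.continuous_fderiv one_ne_zero).comp (by fun_prop)
    exact continuous_const.clm_comp (h1.clm_comp continuous_const)
  have hcontf : Continuous fun p : PhaseSpace N × C(I, Fin N → ℝ) => f p 0 :=
    (ContinuousMap.evalCLM ℝ (1 : I)).continuous.comp (hdiff.continuous.comp (by fun_prop))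
  have hf00 : f (0, 0) 0 = 0 := by
    show S ((0 : PhaseSpace N), (0 : PairSkeleton m), (0 : C(I, Fin N → ℝ))) 1 = 0
    have : ((0 : PhaseSpace N), (0 : PairSkeleton m), (0 : C(I, Fin N → ℝ))) = 0 := rfl
    rw [this, hS0]
    rfl
  have hsurj : LinearMap.range (f' (0, 0) 0 : PairSkeleton m →ₗ[ℝ] PhaseSpace N) = ⊤ := by
    have : ((0 : PhaseSpace N), (0 : PairSkeleton m), (0 : C(I, Fin N → ℝ))) = 0 := rfl
    show LinearMap.range (((ContinuousMap.evalCLM ℝ (1 : I)).comp ((fderiv ℝ S ((0 : PhaseSpace N),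
      (0 : PairSkeleton m), (0 : C(I, Fin N → ℝ)))).comp ι)) : PairSkeleton m →ₗ[ℝ] PhaseSpace N) = ⊤
    rw [this]
    exact hsurjT
  -- nontriviality of the skeleton space
  haveI : Nontrivial (PairSkeleton m) := by
    refine ⟨⟨0, (fun _ => 1, 0), fun h => ?_⟩⟩
    have := congrArg (fun q : PairSkeleton m => q.1 ⟨0, Nat.two_pow_pos m⟩) h
    simp at this
  -- Haar instances on the skeleton space and on phase space
  haveI hpiS : (volume : Measure (Fin (2 ^ m) → ℝ)).IsAddHaarMeasure := isAddHaarMeasure_volume_pi _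
  haveI hpiP : (volume : Measure (Fin N → ℝ)).IsAddHaarMeasure := isAddHaarMeasure_volume_pi _
  haveI hvolS : (volume : Measure (PairSkeleton m)).IsAddHaarMeasure :=
    Measure.prod.instIsAddHaarMeasure (volume : Measure (Fin (2 ^ m) → ℝ)) (volume : Measure (Fin (2 ^ m) → ℝ))
  haveI hvolP : (volume : Measure (PhaseSpace N)).IsAddHaarMeasure :=
    Measure.prod.instIsAddHaarMeasure (volume : Measure (Fin N → ℝ)) (volume : Measure (Fin N → ℝ))
  -- the submersion estimate, uniformly in `(z, ρ)` near `(0, 0)`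
  obtain ⟨V, hV, ρ₀, hρ₀, r, hr, c, hc, hmin⟩ :=
    exists_measure_preimage_ge_of_surjective (volume : Measure (PairSkeleton m))
      (volume : Measure (PhaseSpace N)) f f' (Eventually.of_forall fun q => hf' q.1 q.2)
      hcontf'.continuousAt hcontf.continuousAt hsurj
  rw [hf00] at hmin
  obtain ⟨ε₁, hε₁, hε₁V⟩ := Metric.mem_nhds_iff.1 hV
  -- the law of the skeleton dominates Lebesgue measure on the ball of radius `ρ₀`
  obtain ⟨c₂, hc₂, hskel⟩ := exists_wienerPair_map_pairSkel_ge m ρ₀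
  -- the good remainders
  have hCpos : 0 < (|cL| + |cR| + 1) * (1 + 2 * 2 ^ m) := by positivity
  set ε' : ℝ := ε₁ / 2 / ((|cL| + |cR| + 1) * (1 + 2 * 2 ^ m)) with hε'
  have hε'pos : 0 < ε' := by positivity
  have hε'bound : (|cL| + |cR|) * ((1 + 2 * 2 ^ m) * ε') < ε₁ := by
    have h1 : (|cL| + |cR|) * ((1 + 2 * 2 ^ m) * ε') ≤ (|cL| + |cR| + 1) * ((1 + 2 * 2 ^ m) * ε') :=
      mul_le_mul_of_nonneg_right (by linarith) (by positivity)
    have h2 : (|cL| + |cR| + 1) * ((1 + 2 * 2 ^ m) * ε') = ε₁ / 2 := by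
      rw [hε']; field_simp
    linarith
  -- the set of good remainder pairs (countably many conditions: measurable)
  set GoodR : Set WienerPair := {rr | (∀ n k : ℕ, ((k : ℝ≥0) / 2 ^ n ≤ 1) →
      |rr.1 ((k : ℝ≥0) / 2 ^ n)| ≤ (1 + 2 * 2 ^ m) * ε' ∧ |rr.2 ((k : ℝ≥0) / 2 ^ n)| ≤ (1 + 2 * 2 ^ m) * ε')}
    with hGoodR
  have hGoodRm : MeasurableSet GoodR := by
    have : GoodR = ⋂ n : ℕ, ⋂ k : ℕ, {rr : WienerPair | ((k : ℝ≥0) / 2 ^ n ≤ 1) →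
        |rr.1 ((k : ℝ≥0) / 2 ^ n)| ≤ (1 + 2 * 2 ^ m) * ε' ∧ |rr.2 ((k : ℝ≥0) / 2 ^ n)| ≤ (1 + 2 * 2 ^ m) * ε'} := by
      ext rr; simp [hGoodR]
    rw [this]
    refine MeasurableSet.iInter fun n => MeasurableSet.iInter fun k => ?_
    by_cases hkn : (k : ℝ≥0) / 2 ^ n ≤ 1
    · simp only [hkn, forall_const]
      exact (measurableSet_le ((measurable_pi_apply _).comp measurable_fst).abs measurable_const).inter
        (measurableSet_le ((measurable_pi_apply _).comp measurable_snd).abs measurable_const)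
    · simp [hkn]
  -- the good event of the Brownian pair forces a good remainder
  have hgood_sub : goodEvent ε' 1 ⊆ (pairRem m) ⁻¹' GoodR := by
    intro ω hω n k hk
    exact abs_pairRem_le_of_mem_goodEvent m hω hk
  have hgood_pos : 0 < wienerPair (goodEvent ε' 1) := wienerPair_goodEvent_pos hε'pos 1
  -- the constant
  refine ⟨ε₁, hε₁, r, hr, c₂ * c * wienerPair (goodEvent ε' 1),
    ENNReal.mul_pos (ENNReal.mul_pos hc₂.ne' hc.ne').ne' hgood_pos.ne', fun z hz T hT hTm => ?_⟩
  -- the transition probability as a Wiener integral, factorised through the skeleton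
  have hkernel : (pinnedChain ω₂ lam β γ).transitionKernel N T_L T_R 1 z T =
      wienerPair ((fun ω => (pinnedChain ω₂ lam β γ).solMap N T_L T_R 1 z (pairPath ω)) ⁻¹' T) := by
    have h := pinnedChain_transitionKernel_apply' hω hl hβ.le hγ.le N T_L T_R 1 z hTm
    simpa using h
  -- the integrand `G(x, rr) = 1_T(Φ_1(z, PL x + rr)) 1_{GoodR}(rr)`
  have h1m := pinnedChain_measurable_solMap hω hl hβ.le hγ.le N T_L T_R (1 : ℝ)
  have h2m : Measurable fun q : PairSkeleton m × WienerPair => ((z : PhaseSpace N), pairRecon m q.1 q.2) :=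
    measurable_const.prodMk (measurable_pairRecon m)
  have hsolm : Measurable ((fun p : PhaseSpace N × WienerPair =>
      (pinnedChain ω₂ lam β γ).solMap N T_L T_R 1 p.1 p.2) ∘
      (fun q : PairSkeleton m × WienerPair => ((z : PhaseSpace N), pairRecon m q.1 q.2))) :=
    Measurable.comp h1m h2m
  -- (the composition is kept in `∘` form: unfolding `solMap` in definitional checks is costly)
  let G : PairSkeleton m × WienerPair → ℝ≥0∞ := fun q =>
    ((T.indicator (1 : PhaseSpace N → ℝ≥0∞)) ∘ ((fun p : PhaseSpace N × WienerPair =>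
      (pinnedChain ω₂ lam β γ).solMap N T_L T_R 1 p.1 p.2) ∘
      (fun q : PairSkeleton m × WienerPair => ((z : PhaseSpace N), pairRecon m q.1 q.2)))) q *
      GoodR.indicator 1 q.2
  have hGm : Measurable G :=
    ((measurable_one.indicator hTm).comp hsolm).mul ((measurable_one.indicator hGoodRm).comp measurable_snd)
  -- `G(Ξ ω, R ω) ≤ 1_{Φ_1(z, B ω) ∈ T}`
  have hGle : ∀ ω, G (pairSkel m ω, pairRem m ω) ≤
      ((fun ω => (pinnedChain ω₂ lam β γ).solMap N T_L T_R 1 z (pairPath ω)) ⁻¹' T).indicator 1 ω := by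
    intro ω
    simp only [G, Function.comp_apply]
    rw [pairRecon_pairSkel_pairRem]
    by_cases hmem : (pinnedChain ω₂ lam β γ).solMap N T_L T_R 1 z (pairPath ω) ∈ T
    · rw [indicator_of_mem hmem, indicator_of_mem (show ω ∈ (fun ω => (pinnedChain ω₂ lam β γ).solMap N T_L T_R 1 z (pairPath ω)) ⁻¹' T
        from hmem)]
      simp only [Pi.one_apply, one_mul]
      exact indicator_le_self' (fun _ _ => zero_le_one) _
    · rw [indicator_of_notMem hmem, zero_mul]
      exact zero_le
  -- for a good remainder of the Brownian pair, the inner integral is at least `c₂ c Leb(T)`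
  have hinner : ∀ ω, pairRem m ω ∈ GoodR →
      c₂ * c * volume T ≤ ∫⁻ x, G (x, pairRem m ω) ∂(wienerPair.map (pairSkel m)) := by
    intro ω hωR
    set rr := pairRem m ω with hrr
    have hr1 : Continuous rr.1 := continuous_pairRem_fst m ω
    have hr2 : Continuous rr.2 := continuous_pairRem_snd m ω
    obtain ⟨hr10, hr20⟩ := pairRem_apply_zero m ω
    -- the remainder noise path and its smallness
    have hcI : Continuous fun τ : I => (⟨(τ : ℝ), τ.2.1⟩ : ℝ≥0) := continuous_subtype_val.subtype_mk _
    let ρr : C(I, Fin N → ℝ) := ⟨fun τ i => (if i.val = 0 then cL else 0) * rr.1 ⟨(τ : ℝ), τ.2.1⟩ +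
        (if i.val = N - 1 then cR else 0) * rr.2 ⟨(τ : ℝ), τ.2.1⟩, by
      refine continuous_pi fun i => ?_
      have h1 : Continuous fun τ : I => rr.1 ⟨(τ : ℝ), τ.2.1⟩ := hr1.comp hcI
      have h2 : Continuous fun τ : I => rr.2 ⟨(τ : ℝ), τ.2.1⟩ := hr2.comp hcI
      fun_prop⟩
    have hρr : ∀ (τ : I) (i : Fin N), ρr τ i = (if i.val = 0 then cL else 0) * rr.1 ⟨(τ : ℝ), τ.2.1⟩ +
        (if i.val = N - 1 then cR else 0) * rr.2 ⟨(τ : ℝ), τ.2.1⟩ := fun τ i => rfl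
    have hsmall : ∀ u : ℝ≥0, u ≤ 1 → |rr.1 u| ≤ (1 + 2 * 2 ^ m) * ε' ∧ |rr.2 u| ≤ (1 + 2 * 2 ^ m) * ε' := by
      intro u hu
      exact ⟨abs_le_of_dyadic hr1 (fun n k hk => (hωR n k hk).1) hu,
        abs_le_of_dyadic hr2 (fun n k hk => (hωR n k hk).2) hu⟩
    have hρnorm : ‖ρr‖ < ε₁ := by
      refine (ContinuousMap.norm_lt_iff _ hε₁).2 fun τ => ?_
      refine (pi_norm_le_iff_of_nonneg (by positivity)).2 (fun i => ?_) |>.trans_lt hε'bound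
      rw [Real.norm_eq_abs, hρr]
      obtain ⟨h1, h2⟩ := hsmall ⟨(τ : ℝ), τ.2.1⟩ (by exact_mod_cast τ.2.2)
      have hL' : |(if i.val = 0 then cL else 0) * rr.1 ⟨(τ : ℝ), τ.2.1⟩| ≤ |cL| * ((1 + 2 * 2 ^ m) * ε') := by
        rw [abs_mul]
        refine mul_le_mul ?_ h1 (abs_nonneg _) (abs_nonneg _)
        split_ifs <;> simp
      have hR' : |(if i.val = N - 1 then cR else 0) * rr.2 ⟨(τ : ℝ), τ.2.1⟩| ≤ |cR| * ((1 + 2 * 2 ^ m) * ε') := by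
        rw [abs_mul]
        refine mul_le_mul ?_ h2 (abs_nonneg _) (abs_nonneg _)
        split_ifs <;> simp
      calc _ ≤ |(if i.val = 0 then cL else 0) * rr.1 ⟨(τ : ℝ), τ.2.1⟩| +
            |(if i.val = N - 1 then cR else 0) * rr.2 ⟨(τ : ℝ), τ.2.1⟩| := abs_add_le _ _
        _ ≤ |cL| * ((1 + 2 * 2 ^ m) * ε') + |cR| * ((1 + 2 * 2 ^ m) * ε') := add_le_add hL' hR'
        _ = (|cL| + |cR|) * ((1 + 2 * 2 ^ m) * ε') := by ring
    -- `(z, ρr) ∈ V`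
    have hzρ : ((z, ρr) : PhaseSpace N × C(I, Fin N → ℝ)) ∈ V := by
      refine hε₁V ?_
      rw [mem_ball, Prod.dist_eq, max_lt_iff, dist_zero_right, dist_zero_right]
      exact ⟨hz, hρnorm⟩
    -- the inner integrand is the indicator of `{x | f (z, ρr) x ∈ T}`
    have hGeq : ∀ x, G (x, rr) = ((f (z, ρr)) ⁻¹' T).indicator 1 x := by
      intro x
      simp only [G, Function.comp_apply]
      rw [indicator_of_mem hωR, Pi.one_apply, mul_one,
        solMap_one_pairRecon_eq_skelSol hω hl hβ.le hγ.le T_L T_R m η hη hSapply x hr1 hr2 hr10 hr20 ρr hρr z]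
      rfl
    simp_rw [hGeq]
    have hfTm : MeasurableSet ((f (z, ρr)) ⁻¹' T) :=
      ((hf' (z, ρr) ·) |> fun h => (continuous_iff_continuousAt.2 fun x => (h x).continuousAt)).measurable hTm
    rw [lintegral_indicator_one hfTm]
    calc c₂ * c * volume T = c₂ * (c * volume T) := mul_assoc _ _ _
      _ ≤ c₂ * volume (closedBall (0 : PairSkeleton m) ρ₀ ∩ f (z, ρr) ⁻¹' T) :=
          mul_le_mul' le_rfl (hmin (z, ρr) hzρ T hT hTm)
      _ ≤ wienerPair.map (pairSkel m) (closedBall (0 : PairSkeleton m) ρ₀ ∩ f (z, ρr) ⁻¹' T) :=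
          hskel _ inter_subset_left (measurableSet_closedBall.inter hfTm)
      _ ≤ wienerPair.map (pairSkel m) (f (z, ρr) ⁻¹' T) := measure_mono inter_subset_right
  -- assemble: Wiener integral ≥ factorised integral ≥ good part
  rw [hkernel, ← lintegral_indicator_one ((hTm.preimage
    (pinnedChain_measurable_solMap_pairPath_right hω hl hβ.le hγ.le N T_L T_R 1 z)))]
  calc c₂ * c * wienerPair (goodEvent ε' 1) * volume T
      = c₂ * c * volume T * wienerPair (goodEvent ε' 1) := by ring
    _ ≤ c₂ * c * volume T * wienerPair ((pairRem m) ⁻¹' GoodR) := by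
        gcongr
    _ = ∫⁻ ω, ((pairRem m) ⁻¹' GoodR).indicator (fun _ => c₂ * c * volume T) ω ∂wienerPair := by
        rw [lintegral_indicator_const (hGoodRm.preimage (measurable_pairRem m))]
    _ ≤ ∫⁻ ω, ∫⁻ x, G (x, pairRem m ω) ∂(wienerPair.map (pairSkel m)) ∂wienerPair := by
        refine lintegral_mono fun ω => ?_
        by_cases hωR : pairRem m ω ∈ GoodR
        · rw [indicator_of_mem (show ω ∈ (pairRem m) ⁻¹' GoodR from hωR)]
          exact hinner ω hωR
        · rw [indicator_of_notMem (show ω ∉ (pairRem m) ⁻¹' GoodR from hωR)]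
          exact zero_le
    _ = ∫⁻ ω, G (pairSkel m ω, pairRem m ω) ∂wienerPair := (lintegral_pairSkel_pairRem m hGm).symm
    _ ≤ ∫⁻ ω, ((fun ω => (pinnedChain ω₂ lam β γ).solMap N T_L T_R 1 z (pairPath ω)) ⁻¹' T).indicator 1 ω ∂wienerPair :=
        lintegral_mono hGle

end One

/-! ### Short times: the chain stays near the equilibrium with probability at least one half -/

section Short

variable {ω₂ lam β γ : ℝ} (hω : 0 < ω₂) (hl : 0 ≤ lam) (hβ : 0 ≤ β) (hγ : 0 ≤ γ) (N : ℕ) (T_L T_R : ℝ)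
include hω hl hβ hγ

/-- **Uniform stochastic continuity at the equilibrium**: for every `ε₁ > 0` there is `δ > 0`
such that `P_s(w, B(0, ε₁)) ≥ 1/2` for all `s ≤ δ` and all `‖w‖ < ε₁/2` (the undriven flow moves
by `O(s)` on a sublevel set of the energy, the driven flow is uniformly close to it when the
Brownian pair is small on `[0, s]`, and the latter happens with probability `≥ 1/2` for short
`s` by the Doob bound of `BrownianSupTail.lean`). [folklore] -/
theorem pinnedChain_transitionKernel_ball_ge_half {ε₁ : ℝ} (hε₁ : 0 < ε₁) :
    ∃ δ : ℝ, 0 < δ ∧ ∀ s : ℝ≥0, (s : ℝ) ≤ δ → ∀ w : PhaseSpace N, ‖w‖ < ε₁ / 2 →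
      2⁻¹ ≤ (pinnedChain ω₂ lam β γ).transitionKernel N T_L T_R s w (ball 0 ε₁) := by
  set P := pinnedChain ω₂ lam β γ with hP
  set cL : ℝ := Real.sqrt (2 * γ * T_L) with hcL
  set cR : ℝ := Real.sqrt (2 * γ * T_R) with hcR
  -- energy bound on the ball and a bound of the drift on the sublevel set
  obtain ⟨E₀, hE₀⟩ := (isCompact_closedBall (0 : PhaseSpace N) ε₁).exists_bound_of_continuousOn
    ((pinnedChain_continuous_hamiltonian ω₂ lam β γ N).continuousOn)
  have hE₀' : ∀ w : PhaseSpace N, ‖w‖ ≤ ε₁ → P.hamiltonian N w ≤ E₀ := fun w hw =>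
    (Real.le_norm_self _).trans (hE₀ w (by simpa using hw))
  obtain ⟨CY, hCY⟩ := (pinnedChain_isCompact_setOf_hamiltonian_le hω hl hβ γ N E₀).exists_bound_of_continuousOn
    ((pinnedChain_contDiff_drift ω₂ lam β γ N (n := 0)).continuous.continuousOn)
  have hCY0 : 0 ≤ CY := by
    have h0 : (0 : PhaseSpace N) ∈ {x : PhaseSpace N | P.hamiltonian N x ≤ E₀} :=
      hE₀' 0 (by simp [hε₁.le])
    exact (norm_nonneg _).trans (hCY 0 h0)
  -- continuity in the noise
  obtain ⟨δ₁, hδ₁, hnoise⟩ := pinnedChain_exists_norm_chainFlow_sub_lt hω hl hβ hγ N E₀ 1 1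
    (show (0 : ℝ) < ε₁ / 4 by positivity)
  -- the noise amplitude on the good event
  set a : ℝ := min δ₁ 1 / (|cL| + |cR| + 1) with ha
  have hapos : 0 < a := by positivity
  have habound : (|cL| + |cR|) * a ≤ min δ₁ 1 := by
    rw [ha, mul_div_assoc', div_le_iff₀ (by positivity)]
    have : 0 ≤ min δ₁ 1 := by positivity
    nlinarith
  -- the time scale
  set δ : ℝ := min (a ^ 2 / 4) (min 1 (ε₁ / (4 * (CY + 1)))) with hδ
  have hδpos : 0 < δ := by positivity
  refine ⟨δ, hδpos, fun s hs w hw => ?_⟩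
  have hs1 : (s : ℝ) ≤ 1 := hs.trans ((min_le_right _ _).trans (min_le_left _ _))
  have hsa : (s : ℝ) ≤ a ^ 2 / 4 := hs.trans (min_le_left _ _)
  have hsε : (s : ℝ) ≤ ε₁ / (4 * (CY + 1)) := hs.trans ((min_le_right _ _).trans (min_le_right _ _))
  have hwE : P.hamiltonian N w ≤ E₀ := hE₀' w (by linarith [norm_nonneg w])
  -- on the good event the solution is in the ball
  have hsub : goodEvent a s ⊆ (fun ω => P.solMap N T_L T_R s w (pairPath ω)) ⁻¹' ball 0 ε₁ := by
    intro ω hωg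
    rw [mem_preimage, mem_ball, dist_zero_right]
    set ηω : ℝ → Fin N → ℝ := chainNoise N cL cR (pairPath ω) with hηω
    have hηc : Continuous ηω := continuous_chainNoise cL cR (pairPath ω)
    have hηsmall : ∀ t ∈ Icc (0 : ℝ) s, ‖ηω t‖ ≤ min δ₁ 1 := by
      intro t ht
      obtain ⟨h1, h2⟩ := abs_brownian_toNNReal_le_of_mem_goodEvent hωg ht.2
      refine (norm_chainNoise_pairPath_le cL cR ω t).trans (le_trans ?_ habound)
      have hcL0 : 0 ≤ |cL| := abs_nonneg _
      have hcR0 : 0 ≤ |cR| := abs_nonneg _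
      nlinarith [mul_le_mul_of_nonneg_left h1 hcL0, mul_le_mul_of_nonneg_left h2 hcR0]
    -- extend the bounds to `[0, 1]`? No: apply the noise continuity on `[0, 1]` needs bounds on
    -- `[0, 1]`; instead apply it with the noises restricted: use `T = 1` but noises agree...
    -- We use the flow only up to time `s ≤ 1`, so restrict attention via `min`: replace the noise
    -- by its stopped version `t ↦ ηω (min t s)`, which is bounded by `min δ₁ 1` on `[0, 1]` and
    -- agrees with `ηω` on `[0, s]`.
    set ηs : ℝ → Fin N → ℝ := fun t => ηω (min t s) with hηs
    have hηsc : Continuous ηs := hηc.comp (continuous_id.min continuous_const)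
    have hηs_bound : ∀ t ∈ Icc (0 : ℝ) 1, ‖ηs t‖ ≤ min δ₁ 1 := fun t ht =>
      hηsmall (min t s) ⟨le_min ht.1 s.coe_nonneg, min_le_right _ _⟩
    have hflow_s : P.chainFlow N w ηω s = P.chainFlow N w ηs s :=
      pinnedChain_chainFlow_congr hω hl hβ hγ N w hηc hηsc (T := s)
        (fun t ht => by simp [hηs, min_eq_left ht.2]) ⟨s.coe_nonneg, le_rfl⟩
    have h1 : ‖P.chainFlow N w ηs s - P.chainFlow N w 0 s‖ < ε₁ / 4 :=
      hnoise w hwE ηs 0 hηsc continuous_zero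
        (fun t ht => (hηs_bound t ht).trans (min_le_right _ _)) (fun t _ => by simp)
        (fun t ht => by simpa using (hηs_bound t ht).trans (min_le_left _ _)) s ⟨s.coe_nonneg, hs1⟩
    -- the undriven flow moves by at most `s CY`
    have h2 : ‖P.chainFlow N w 0 s - w‖ ≤ s * CY := by
      rw [pinnedChain_freeFlow_eq_integral hω hl hβ hγ N w s.coe_nonneg, add_sub_cancel_left]
      have hb : ∀ u ∈ Set.uIoc (0 : ℝ) s, ‖P.drift N (P.chainFlow N w 0 u)‖ ≤ CY := by
        intro u _
        refine hCY _ ?_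
        exact (pinnedChain_freeFlow_mem_sublevel hω hl hβ hγ N w u).trans hwE
      have := intervalIntegral.norm_integral_le_of_norm_le_const hb
      rwa [sub_zero, abs_of_nonneg s.coe_nonneg, mul_comm] at this
    have h2' : (s : ℝ) * CY < ε₁ / 4 := by
      calc (s : ℝ) * CY ≤ ε₁ / (4 * (CY + 1)) * CY := mul_le_mul_of_nonneg_right hsε hCY0
        _ < ε₁ / 4 := by
            rw [div_mul_eq_mul_div, div_lt_div_iff₀ (by positivity) (by positivity)]
            nlinarith
    have hsol : P.solMap N T_L T_R s w (pairPath ω) = P.chainFlow N w ηω s := rfl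
    rw [hsol, hflow_s]
    calc ‖P.chainFlow N w ηs s‖ = ‖(P.chainFlow N w ηs s - P.chainFlow N w 0 s) +
          (P.chainFlow N w 0 s - w) + w‖ := by congr 1; abel
      _ ≤ ‖P.chainFlow N w ηs s - P.chainFlow N w 0 s‖ + ‖P.chainFlow N w 0 s - w‖ + ‖w‖ := norm_add₃_le
      _ < ε₁ / 4 + ε₁ / 4 + ε₁ / 2 := by linarith
      _ = ε₁ := by ring
  -- probability of the good event
  have hgood : 2⁻¹ ≤ wienerPair (goodEvent a s) := by
    have hsa' : (s : ℝ) < a ^ 2 := by nlinarith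
    have hcompl := measure_compl_goodEvent_le hapos.le s hsa'
    have hbound : 2 * ENNReal.ofReal (2 * (s : ℝ) ^ 2 / (a ^ 2 - s) ^ 2) ≤ 2⁻¹ := by
      have hden : 3 * a ^ 2 / 4 ≤ a ^ 2 - s := by nlinarith
      have hden0 : 0 < 3 * a ^ 2 / 4 := by positivity
      have hs0 : (0 : ℝ) ≤ s := s.coe_nonneg
      have hreal : 2 * (s : ℝ) ^ 2 / (a ^ 2 - s) ^ 2 ≤ 2 / 9 := by
        rw [div_le_div_iff₀ (by positivity) (by norm_num)]
        have h1 : (s : ℝ) ^ 2 ≤ (a ^ 2 / 4) ^ 2 := pow_le_pow_left₀ hs0 hsa 2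
        have h2 : (3 * a ^ 2 / 4) ^ 2 ≤ (a ^ 2 - s) ^ 2 := pow_le_pow_left₀ hden0.le hden 2
        nlinarith
      calc 2 * ENNReal.ofReal (2 * (s : ℝ) ^ 2 / (a ^ 2 - s) ^ 2) ≤ 2 * ENNReal.ofReal (2 / 9) := by
            gcongr
        _ = ENNReal.ofReal (4 / 9) := by
            rw [← ENNReal.ofReal_ofNat, ← ENNReal.ofReal_mul (by norm_num)]; norm_num
        _ ≤ ENNReal.ofReal (1 / 2) := ENNReal.ofReal_le_ofReal (by norm_num)
        _ = 2⁻¹ := by rw [one_div, ENNReal.ofReal_inv_of_pos two_pos, ENNReal.ofReal_ofNat]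
    have hprob : wienerPair (goodEvent a s) = 1 - wienerPair (goodEvent a s)ᶜ := by
      rw [prob_compl_eq_one_sub (measurableSet_goodEvent a s), ENNReal.sub_sub_cancel ENNReal.one_ne_top prob_le_one]
    rw [hprob]
    have h3 : wienerPair (goodEvent a s)ᶜ ≤ 2⁻¹ := hcompl.trans hbound
    calc (2⁻¹ : ℝ≥0∞) = 1 - 2⁻¹ := by norm_num [ENNReal.one_sub_inv_two]
      _ ≤ 1 - wienerPair (goodEvent a s)ᶜ := tsub_le_tsub_left h3 1
  rw [pinnedChain_transitionKernel_apply' hω hl hβ hγ N T_L T_R s w measurableSet_ball]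
  exact hgood.trans (measure_mono hsub)

end Short

/-! ### The local small set at the equilibrium (hypothesis `hloc`), and Theorem 2.13 -/

section LocalSmall

variable {ω₂ lam β γ : ℝ} (hω : 0 < ω₂) (hl : 0 ≤ lam) (hβ : 0 < β) (hγ : 0 < γ)
  (hN : 0 < N) {T_L T_R : ℝ} (hL : 0 < T_L) (hR : 0 < T_R)
include hω hl hβ hγ hN hL hR

/-- **The pinned chain has a local small set at its equilibrium** (hypothesis `hloc` of
`CuneoEckmannHairerReyBellet2018_thm213_of_H2_of_localSmall_of_hormander`, PROVED): there are an
open `G₀ ∋ 0`, a nonempty open `U₀`, `η > 0` and a time window `[t₀ - δ, t₀ + δ] = [1, 1 + 2δ]`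
with `P_t(w, ·) ≥ η · Leb|_{U₀}` for all `w ∈ G₀` and `t` in the window: minorisation at time
one (`pinnedChain_minorization_at_one`) composed, by Chapman–Kolmogorov, with the uniform bound
`P_s(w, B(0,ε₁)) ≥ 1/2` for short `s` (`pinnedChain_transitionKernel_ball_ge_half`).
[cite: CuneoEckmannHairerReyBellet2018, Prop 3.6] -/
theorem pinnedChain_localSmall :
    ∃ (G₀ U₀ : Set (PhaseSpace N)) (η : ℝ≥0∞) (t₀ δ : ℝ), IsOpen G₀ ∧ (0 : PhaseSpace N) ∈ G₀ ∧
      IsOpen U₀ ∧ U₀.Nonempty ∧ 0 < η ∧ 0 < δ ∧ δ ≤ t₀ ∧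
      ∀ t : ℝ≥0, t₀ - δ ≤ (t : ℝ) → (t : ℝ) ≤ t₀ + δ → ∀ w ∈ G₀,
        η • (volume : Measure (PhaseSpace N)).restrict U₀ ≤
          (pinnedChain ω₂ lam β γ).transitionKernel N T_L T_R t w := by
  set P := pinnedChain ω₂ lam β γ with hP
  set S := pinnedChainSemigroup hω hl hβ.le hγ.le hN hL.le hR.le with hS
  obtain ⟨ε₁, hε₁, r, hr, c, hc, hmin⟩ := pinnedChain_minorization_at_one hω hl hβ hγ hN hL hR
  obtain ⟨δ, hδ, hhalf⟩ := pinnedChain_transitionKernel_ball_ge_half hω hl hβ.le hγ.le N T_L T_R hε₁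
  -- the minorising measure at time one on the ball `B(0, ε₁)`
  set ν : Measure (PhaseSpace N) := c • (volume : Measure (PhaseSpace N)).restrict (ball 0 r) with hν
  have hν1 : ∀ w' ∈ ball (0 : PhaseSpace N) ε₁, ν ≤ S.kernel 1 w' := by
    intro w' hw'
    refine Measure.le_iff.2 fun A hA => ?_
    rw [hν, Measure.smul_apply, Measure.restrict_apply hA, smul_eq_mul]
    have hw'n : ‖w'‖ < ε₁ := by simpa using hw'
    exact (hmin w' hw'n (A ∩ ball 0 r) inter_subset_right (hA.inter measurableSet_ball)).trans
      (measure_mono inter_subset_left)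
  refine ⟨ball 0 (ε₁ / 2), ball 0 r, 2⁻¹ * c, 1 + δ / 2, δ / 2, isOpen_ball, mem_ball_self (by positivity),
    isOpen_ball, ⟨0, mem_ball_self hr⟩, ENNReal.mul_pos (by simp) hc.ne', by positivity, by linarith,
    fun t ht1 ht2 w hw => ?_⟩
  -- `t = s + 1` with `s ≤ δ`
  have ht1' : (1 : ℝ) ≤ t := by linarith
  set s : ℝ≥0 := t - 1 with hs
  have hts : t = s + 1 := by
    rw [hs, tsub_add_cancel_of_le (by exact_mod_cast ht1')]
  have hsδ : (s : ℝ) ≤ δ := by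
    have : ((t - 1 : ℝ≥0) : ℝ) = t - 1 := NNReal.coe_sub (by exact_mod_cast ht1')
    rw [hs, this]; linarith
  have hwn : ‖w‖ < ε₁ / 2 := by simpa using hw
  -- Chapman–Kolmogorov
  have hck := MarkovSemigroup.smul_le_comp S.kernel S.kernel_add s 1 w (ball 0 ε₁) hν1
  have hhalf' : 2⁻¹ ≤ S.kernel s w (ball 0 ε₁) := hhalf s hsδ w hwn
  rw [hts]
  calc (2⁻¹ * c) • (volume : Measure (PhaseSpace N)).restrict (ball 0 r) = (2⁻¹ : ℝ≥0∞) • ν := by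
        rw [hν, smul_smul]
    _ ≤ (S.kernel s w (ball 0 ε₁)) • ν := IsOrderedSMul.smul_le_smul_right _ _ hhalf' ν
    _ ≤ S.kernel (s + 1) w := hck

omit hω hl hβ hγ hN hL hR in
/-- **Cuneo–Eckmann–Hairer–Rey-Bellet 2018, Theorem 2.13 for the pinned chain, from the named
facts H2 (CEHR Thm 5.1 / Rem 5.2) and Hörmander 1967 Thm 1.1 ALONE.** Everything else in CEHR §3
is now proved for the constructed transition semigroup: Krylov–Bogoliubov existence, pointed
irreducibility (`LangevinChainReach.lean`), the local small set at the equilibrium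
(`pinnedChain_localSmall`, Hörmander-free), Prop. 3.6 (`LangevinChainMinorization.lean`), Harris'
theorem and (2.5) (`LangevinChainHarris.lean`); Hörmander's theorem enters only through the
smoothness of the invariant density. [cite: CuneoEckmannHairerReyBellet2018, Thm 2.13] -/
theorem CuneoEckmannHairerReyBellet2018_thm213_of_H2_of_hormander
    (h2 : CuneoEckmannHairerReyBellet2018_H2)
    (hH : Literature.Analysis.Distribution.Hormander1967_thm11) :
    CuneoEckmannHairerReyBellet2018_thm213 :=
  CuneoEckmannHairerReyBellet2018_thm213_of_H2_of_localSmall_of_hormander h2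
    (fun _ _ _ _ hω' hl' hβ' hγ' _ _ _ hN' hL' hR' => pinnedChain_localSmall hω' hl' hβ' hγ' hN' hL' hR') hH

end LocalSmall

end Literature.MathematicalPhysics.KineticTheory.HeatConduction
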